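import Mathlib
import Literature.Probability.PointProcesses.LensConsistentLaw
import Literature.MathematicalPhysics.StatisticalMechanics.TransferLevelValue
import Literature.MathematicalPhysics.StatisticalMechanics.LennardJonesClusters
import Summits.AtomisticToContinuum.Crystallization.Theorems.FrustrationRangeCertificatesPatternPricedCertificatesStubBanachLimit
import Summits.AtomisticToContinuum.Crystallization.Theorems.FrustrationRangeCertificatesPatternPricedCertificatesStubLevelRestrict
import Summits.AtomisticToContinuum.Crystallization.Theorems.FrustrationRangeCertificatesPatternPricedCertificatesStubPatternFarField
import Summits.AtomisticToContinuum.Crystallization.Theorems.FrustrationRangeCertificatesPatternPricedCertificatesStubMeanDuality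
import HarnessLib

/-!
# Crux `PatternPricedCertificates` (stmt-AtomisticToContinuum-12974), line `registered` — stub `stub_levelLift`

**The level lift (primal side, finitely additive laws).** Fix the data `P, δ, R, ε, κ, c`. A MEAN at
level `(δ, L)` is a functional `m` on all pattern functionals `Finset E → ℝ` (`E = ℝ³`) which is
additive, homogeneous, nonnegative on functionals valued in `[0, 1]` on the `(δ, L)`-admissible rooted
patterns and normalised; it is LENS-CONSISTENT at `(r, L)` if it kills the transport
`T^{(r,L)}_g S = Σ_{v ∈ lens r L S} [g v (B_r S) (B_r (reroot S v)) − g (−v) (B_r (reroot S v)) (B_r S)]`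
of every bounded rule `g`. A POINT-STATIONARY MEAN FAMILY is `ℓ : ℝ → (Finset E → ℝ) → ℝ`, each `ℓ ρ`
a mean at level `(δ, ρ)`, projective (`ℓ ρ' (f ∘ B_ρ) = ℓ ρ f`, `ρ ≤ ρ'`) and lens-consistent at every
level `(r, ρ)`, `0 ≤ r`. The stub: if every point-stationary mean family satisfies the priced
inequality `c + κ ℓ ρ (bad) ≤ ℓ ρ (½ h)` at every radius `ρ ≥ max (R + ε) 1`, then for every `η > 0`
and `L₀` there is a level `(r, L)` (`L₀ ≤ L`, `R + ε ≤ L`, `0 ≤ r ≤ L`) at which every lens-consistent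
mean satisfies `c − η + κ m (bad) ≤ m (½ h)`.

**Proof (ultralimit).** If not, along `L_n = B + 2n`, `r_n = n` (`B = max L₀ (max (R + ε) 1)`) there
are lens-consistent means `m_n` with `m_n (½ h) < c − η + κ m_n (bad)`. With the generalised limit `Λ`
of `stub_banachLimit` put `ℓ ρ f := Λ (n ↦ m_n (f ∘ B_ρ))`. Each `ℓ ρ` is a mean (the `ρ`-ball of an
admissible pattern is admissible), the family is projective (`B_ρ ∘ B_{ρ'} = B_ρ`) and lens-consistent
at every level: by `stub_levelRestrict`, `T^{(r,ρ)}_g ∘ B_ρ = T^{(n, L_n)}_{ĝ}` for `n ≥ r`, `B + n ≥ ρ − r`,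
which `m_n` kills, and `Λ` ignores finitely many terms. The defect indicator is a cylinder functional
of radius `R + ε` (`bad ∘ B_ρ = bad` for `ρ ≥ R + ε`), and by the pattern-level far field
(`stub_patternFarField`) `½ h ∘ B_ρ ≤ ½ h + η/2` on admissible patterns once `ρ ≥ ρ₀(δ, η)`; so at
`ρ = max (max (R + ε) 1) ρ₀` the hypothesis gives `c + κ Λ b ≤ ℓ ρ (½ h) ≤ c − η/2 + κ Λ b`
(`b_n = m_n (bad)`), a contradiction. No new definitions; nothing is assumed. [folklore]
-/

noncomputable section

open scoped BigOperators Classical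

namespace Summit.AtomisticToContinuum.Crystallization.Theorems.PatternPricedCertificates

open Literature.Probability.PointProcesses (IsRootedPattern ballPattern lens reroot)
open Literature.MathematicalPhysics.StatisticalMechanics (lennardJones)

section MeanLemmas

variable {α : Type*}

/-- A mean is subtractive. [folklore] -/
theorem levelLift_mean_sub {m : (α → ℝ) → ℝ} (hadd : ∀ f₁ f₂ : α → ℝ, m (f₁ + f₂) = m f₁ + m f₂)
    (hsmul : ∀ (t : ℝ) (f : α → ℝ), m (t • f) = t * m f) (f g : α → ℝ) : m (f - g) = m f - m g := by
  have h : f - g = f + (-1 : ℝ) • g := by ext x; simp; ring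
  rw [h, hadd, hsmul]; ring

/-- A mean of a constant is the constant. [folklore] -/
theorem levelLift_mean_const {m : (α → ℝ) → ℝ}
    (hsmul : ∀ (t : ℝ) (f : α → ℝ), m (t • f) = t * m f) (hone : m (fun _ => 1) = 1) (t : ℝ) :
    m (fun _ => t) = t := by
  have h : (fun _ : α => t) = t • (fun _ : α => (1 : ℝ)) := by ext x; simp
  rw [h, hsmul, hone, mul_one]

/-- Means are monotone on functions whose difference is bounded on the index set. [folklore] -/
theorem levelLift_mean_mono {m : (α → ℝ) → ℝ} {Ω : α → Prop}
    (hadd : ∀ f₁ f₂ : α → ℝ, m (f₁ + f₂) = m f₁ + m f₂)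
    (hsmul : ∀ (t : ℝ) (f : α → ℝ), m (t • f) = t * m f)
    (hpos : ∀ f : α → ℝ, (∀ x, Ω x → 0 ≤ f x ∧ f x ≤ 1) → 0 ≤ m f)
    {f g : α → ℝ} {M : ℝ} (hM : 0 < M) (hfg : ∀ x, Ω x → f x ≤ g x)
    (hbd : ∀ x, Ω x → g x - f x ≤ M) : m f ≤ m g := by
  have h1 : 0 ≤ m (M⁻¹ • (g - f)) := by
    refine hpos _ fun x hx => ?_
    simp only [Pi.smul_apply, Pi.sub_apply, smul_eq_mul]
    constructor
    · exact mul_nonneg (inv_nonneg.2 hM.le) (sub_nonneg.2 (hfg x hx))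
    · rw [inv_mul_le_iff₀ hM, mul_one]
      exact hbd x hx
  rw [hsmul, levelLift_mean_sub hadd hsmul] at h1
  have h2 : 0 ≤ m g - m f := by
    by_contra h
    have : M⁻¹ * (m g - m f) < 0 := mul_neg_of_pos_of_neg (inv_pos.2 hM) (not_le.1 h)
    linarith
  linarith

/-- A mean of a function with values in `[lo, hi]` on the index set lies in `[lo, hi]`. [folklore] -/
theorem levelLift_mean_mem_Icc {m : (α → ℝ) → ℝ} {Ω : α → Prop}
    (hadd : ∀ f₁ f₂ : α → ℝ, m (f₁ + f₂) = m f₁ + m f₂)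
    (hsmul : ∀ (t : ℝ) (f : α → ℝ), m (t • f) = t * m f)
    (hpos : ∀ f : α → ℝ, (∀ x, Ω x → 0 ≤ f x ∧ f x ≤ 1) → 0 ≤ m f)
    (hone : m (fun _ => 1) = 1)
    {f : α → ℝ} {lo hi : ℝ} (hlh : lo < hi) (hf : ∀ x, Ω x → lo ≤ f x ∧ f x ≤ hi) :
    lo ≤ m f ∧ m f ≤ hi := by
  constructor
  · have h := levelLift_mean_mono (Ω := Ω) hadd hsmul hpos (f := fun _ => lo) (g := f) (M := hi - lo)
      (by linarith) (fun x hx => (hf x hx).1) (fun x hx => by linarith [(hf x hx).2])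
    rwa [levelLift_mean_const hsmul hone] at h
  · have h := levelLift_mean_mono (Ω := Ω) hadd hsmul hpos (f := f) (g := fun _ => hi) (M := hi - lo)
      (by linarith) (fun x hx => (hf x hx).2) (fun x hx => by linarith [(hf x hx).1])
    rwa [levelLift_mean_const hsmul hone] at h

end MeanLemmas

section PatternLemmas

/-- Uniform bound on the Lennard-Jones potential beyond the hard core: `|V_LJ s| ≤ δ⁻¹²/12 + δ⁻⁶/6`
for `s ≥ δ > 0`. [folklore] -/
theorem levelLift_abs_lennardJones_le {δ s : ℝ} (hδ : 0 < δ) (hs : δ ≤ s) :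
    |lennardJones s| ≤ (1 / 12) * (δ⁻¹) ^ 12 + (1 / 6) * (δ⁻¹) ^ 6 := by
  have hs0 : 0 < s := hδ.trans_le hs
  have hinv : s⁻¹ ≤ δ⁻¹ := (inv_le_inv₀ hs0 hδ).2 hs
  have hinv0 : 0 ≤ s⁻¹ := inv_nonneg.2 hs0.le
  have h12 : (s⁻¹) ^ 12 ≤ (δ⁻¹) ^ 12 := pow_le_pow_left₀ hinv0 hinv 12
  have h6 : (s⁻¹) ^ 6 ≤ (δ⁻¹) ^ 6 := pow_le_pow_left₀ hinv0 hinv 6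
  unfold Literature.MathematicalPhysics.StatisticalMechanics.lennardJones
  refine (abs_sub _ _).trans ?_
  rw [abs_of_nonneg (by positivity), abs_of_nonneg (by positivity)]
  gcongr

/-- The truncated one-centre energy is bounded on admissible patterns (packing bound
`meanDuality_card_le` times the bound on `V_LJ` beyond the hard core). [folklore] -/
theorem levelLift_abs_sum_le {δ : ℝ} (hδ : 0 < δ) (L : ℝ) :
    ∃ M : ℝ, ∀ S : Finset (EuclideanSpace ℝ (Fin 3)), IsRootedPattern δ L S →
      |∑ v ∈ S, lennardJones ‖v‖| ≤ M := by
  set B : ℝ := (1 / 12) * (δ⁻¹) ^ 12 + (1 / 6) * (δ⁻¹) ^ 6 with hB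
  refine ⟨(2 * max L 0 / δ + 1) ^ 3 * B, fun S hS => ?_⟩
  have hB0 : 0 ≤ B := by positivity
  calc |∑ v ∈ S, lennardJones ‖v‖| ≤ ∑ v ∈ S, |lennardJones ‖v‖| := Finset.abs_sum_le_sum_abs _ _
    _ ≤ ∑ _v ∈ S, B := Finset.sum_le_sum fun v hv => levelLift_abs_lennardJones_le hδ (hS.1 v hv).1
    _ = S.card * B := by rw [Finset.sum_const, nsmul_eq_mul]
    _ ≤ (2 * max L 0 / δ + 1) ^ 3 * B := by gcongr; exact meanDuality_card_le hδ hS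

/-- The `ρ`-ball of an admissible pattern is an admissible pattern of radius `ρ`. [folklore] -/
theorem levelLift_isRootedPattern_ballPattern {δ L : ℝ} (ρ : ℝ)
    {S : Finset (EuclideanSpace ℝ (Fin 3))} (hS : IsRootedPattern δ L S) :
    IsRootedPattern δ ρ (ballPattern ρ S) := by
  refine ⟨fun v hv => ?_, fun v hv w hw hvw => ?_⟩
  · simp only [ballPattern, Finset.mem_filter] at hv
    exact ⟨(hS.1 v hv.1).1, hv.2⟩
  · simp only [ballPattern, Finset.mem_filter] at hv hw
    exact hS.2 v hv.1 w hw.1 hvw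

/-- **The defect indicator is a cylinder functional of radius `R + ε`:** the `(R, ε)`-matching
predicate of `insert 0 S` only reads the points of `S` of norm `≤ R + ε` (a point matched to `A p`,
`‖p‖ ≤ R`, has norm `≤ R + ε`; the second clause only tests points of norm `≤ R`). [folklore] -/
theorem levelLift_good_ballPattern_iff
    (P : Literature.MathematicalPhysics.StatisticalMechanics.PeriodicConfiguration 3) {R ε ρ : ℝ}
    (hε : 0 ≤ ε) (hρ : R + ε ≤ ρ) (S : Finset (EuclideanSpace ℝ (Fin 3))) :
    (∃ A : EuclideanSpace ℝ (Fin 3) →ₗᵢ[ℝ] EuclideanSpace ℝ (Fin 3),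
        (∀ p ∈ P.points, ‖p‖ ≤ R → ∃ v ∈ insert (0 : EuclideanSpace ℝ (Fin 3)) (ballPattern ρ S), dist v (A p) ≤ ε) ∧
        (∀ v ∈ insert (0 : EuclideanSpace ℝ (Fin 3)) (ballPattern ρ S), ‖v‖ ≤ R → ∃ p ∈ P.points, dist v (A p) ≤ ε)) ↔
    (∃ A : EuclideanSpace ℝ (Fin 3) →ₗᵢ[ℝ] EuclideanSpace ℝ (Fin 3),
        (∀ p ∈ P.points, ‖p‖ ≤ R → ∃ v ∈ insert (0 : EuclideanSpace ℝ (Fin 3)) S, dist v (A p) ≤ ε) ∧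
        (∀ v ∈ insert (0 : EuclideanSpace ℝ (Fin 3)) S, ‖v‖ ≤ R → ∃ p ∈ P.points, dist v (A p) ≤ ε)) := by
  have hsub : ∀ v, v ∈ insert (0 : EuclideanSpace ℝ (Fin 3)) (ballPattern ρ S) →
      v ∈ insert (0 : EuclideanSpace ℝ (Fin 3)) S := by
    intro v hv
    rcases Finset.mem_insert.1 hv with rfl | hv
    · exact Finset.mem_insert_self _ _
    · simp only [ballPattern, Finset.mem_filter] at hv
      exact Finset.mem_insert_of_mem hv.1
  have hsup : ∀ v, v ∈ insert (0 : EuclideanSpace ℝ (Fin 3)) S → ‖v‖ ≤ ρ →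
      v ∈ insert (0 : EuclideanSpace ℝ (Fin 3)) (ballPattern ρ S) := by
    intro v hv hvρ
    rcases Finset.mem_insert.1 hv with rfl | hv
    · exact Finset.mem_insert_self _ _
    · refine Finset.mem_insert_of_mem ?_
      simp only [ballPattern, Finset.mem_filter]
      exact ⟨hv, hvρ⟩
  constructor
  · rintro ⟨A, h1, h2⟩
    refine ⟨A, fun p hp hpR => ?_, fun v hv hvR => ?_⟩
    · obtain ⟨v, hv, hvp⟩ := h1 p hp hpR
      exact ⟨v, hsub v hv, hvp⟩
    · exact h2 v (hsup v hv (by linarith)) hvR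
  · rintro ⟨A, h1, h2⟩
    refine ⟨A, fun p hp hpR => ?_, fun v hv hvR => ?_⟩
    · obtain ⟨v, hv, hvp⟩ := h1 p hp hpR
      refine ⟨v, hsup v hv ?_, hvp⟩
      calc ‖v‖ = dist v 0 := (dist_zero_right v).symm
        _ ≤ dist v (A p) + dist (A p) 0 := dist_triangle _ _ _
        _ ≤ ε + R := by
            rw [dist_zero_right, A.norm_map]
            exact add_le_add hvp hpR
        _ ≤ ρ := by linarith
    · exact h2 v (hsub v hv) hvR

end PatternLemmas

/-- **Stub `stub_levelLift` (level lift, primal side, finitely additive laws).** For fixed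
`P, δ, R, ε, κ, c`, the level-∞ priced inequality over point-stationary mean families implies, for
every `η > 0` and `L₀`, the finite-level priced inequality `c − η + κ m(bad) ≤ m(½ h)` for all
lens-consistent means `m` at some level `(r, L)` with `L₀ ≤ L`, `R + ε ≤ L`, `0 ≤ r ≤ L` — by the
ultralimit construction described in the module docstring (`stub_banachLimit`,
`stub_levelRestrict`, `stub_patternFarField`). [folklore] -/
theorem stub_levelLift :
    ∀ (P : Literature.MathematicalPhysics.StatisticalMechanics.PeriodicConfiguration 3) (δ R ε κ c : ℝ), 0 < δ → 0 < R → 0 < ε →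
      (∀ ℓ : ℝ → (Finset (EuclideanSpace ℝ (Fin 3)) → ℝ) → ℝ,
        (∀ (ρ : ℝ) (f₁ f₂ : Finset (EuclideanSpace ℝ (Fin 3)) → ℝ), ℓ ρ (f₁ + f₂) = ℓ ρ f₁ + ℓ ρ f₂) →
        (∀ (ρ t : ℝ) (f : Finset (EuclideanSpace ℝ (Fin 3)) → ℝ), ℓ ρ (t • f) = t * ℓ ρ f) →
        (∀ (ρ : ℝ) (f : Finset (EuclideanSpace ℝ (Fin 3)) → ℝ), (∀ S : Finset (EuclideanSpace ℝ (Fin 3)), Literature.Probability.PointProcesses.IsRootedPattern δ ρ S → 0 ≤ f S ∧ f S ≤ 1) → 0 ≤ ℓ ρ f) →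
        (∀ ρ : ℝ, ℓ ρ (fun _ => 1) = 1) →
        (∀ ρ ρ' : ℝ, ρ ≤ ρ' → ∀ f : Finset (EuclideanSpace ℝ (Fin 3)) → ℝ, ℓ ρ' (fun S => f (Literature.Probability.PointProcesses.ballPattern ρ S)) = ℓ ρ f) →
        (∀ r ρ : ℝ, 0 ≤ r → ∀ g : EuclideanSpace ℝ (Fin 3) → Finset (EuclideanSpace ℝ (Fin 3)) → Finset (EuclideanSpace ℝ (Fin 3)) → ℝ, (∃ M : ℝ, ∀ v p q, |g v p q| ≤ M) →
          ℓ ρ (fun S => ∑ v ∈ Literature.Probability.PointProcesses.lens r ρ S, (g v (Literature.Probability.PointProcesses.ballPattern r S) (Literature.Probability.PointProcesses.ballPattern r (Literature.Probability.PointProcesses.reroot S v)) - g (-v) (Literature.Probability.PointProcesses.ballPattern r (Literature.Probability.PointProcesses.reroot S v)) (Literature.Probability.PointProcesses.ballPattern r S))) = 0) →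
        ∀ ρ : ℝ, R + ε ≤ ρ → 1 ≤ ρ →
          c + κ * ℓ ρ (fun S => (if (∃ A : EuclideanSpace ℝ (Fin 3) →ₗᵢ[ℝ] EuclideanSpace ℝ (Fin 3), (∀ p ∈ P.points, ‖p‖ ≤ R → ∃ v ∈ insert (0 : EuclideanSpace ℝ (Fin 3)) S, dist v (A p) ≤ ε) ∧ (∀ v ∈ insert (0 : EuclideanSpace ℝ (Fin 3)) S, ‖v‖ ≤ R → ∃ p ∈ P.points, dist v (A p) ≤ ε)) then (0 : ℝ) else 1)) ≤
            ℓ ρ (fun S => (∑ v ∈ S, Literature.MathematicalPhysics.StatisticalMechanics.lennardJones ‖v‖) / 2)) →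
      ∀ η : ℝ, 0 < η → ∀ L₀ : ℝ, ∃ L r : ℝ, L₀ ≤ L ∧ R + ε ≤ L ∧ 0 ≤ r ∧ r ≤ L ∧
        ∀ m : (Finset (EuclideanSpace ℝ (Fin 3)) → ℝ) → ℝ,
          (∀ f₁ f₂ : Finset (EuclideanSpace ℝ (Fin 3)) → ℝ, m (f₁ + f₂) = m f₁ + m f₂) →
          (∀ (t : ℝ) (f : Finset (EuclideanSpace ℝ (Fin 3)) → ℝ), m (t • f) = t * m f) →
          (∀ f : Finset (EuclideanSpace ℝ (Fin 3)) → ℝ, (∀ S : Finset (EuclideanSpace ℝ (Fin 3)), Literature.Probability.PointProcesses.IsRootedPattern δ L S → 0 ≤ f S ∧ f S ≤ 1) → 0 ≤ m f) →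
          m (fun _ => 1) = 1 →
          (∀ g : EuclideanSpace ℝ (Fin 3) → Finset (EuclideanSpace ℝ (Fin 3)) → Finset (EuclideanSpace ℝ (Fin 3)) → ℝ, (∃ M : ℝ, ∀ v p q, |g v p q| ≤ M) →
            m (fun S => ∑ v ∈ Literature.Probability.PointProcesses.lens r L S, (g v (Literature.Probability.PointProcesses.ballPattern r S) (Literature.Probability.PointProcesses.ballPattern r (Literature.Probability.PointProcesses.reroot S v)) - g (-v) (Literature.Probability.PointProcesses.ballPattern r (Literature.Probability.PointProcesses.reroot S v)) (Literature.Probability.PointProcesses.ballPattern r S))) = 0) →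
          c - η + κ * m (fun S => (if (∃ A : EuclideanSpace ℝ (Fin 3) →ₗᵢ[ℝ] EuclideanSpace ℝ (Fin 3), (∀ p ∈ P.points, ‖p‖ ≤ R → ∃ v ∈ insert (0 : EuclideanSpace ℝ (Fin 3)) S, dist v (A p) ≤ ε) ∧ (∀ v ∈ insert (0 : EuclideanSpace ℝ (Fin 3)) S, ‖v‖ ≤ R → ∃ p ∈ P.points, dist v (A p) ≤ ε)) then (0 : ℝ) else 1)) ≤
            m (fun S => (∑ v ∈ S, Literature.MathematicalPhysics.StatisticalMechanics.lennardJones ‖v‖) / 2) := by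
  intro P δ R ε κ c hδ _hR hε hprim η hη L₀
  by_contra hcon
  push Not at hcon
  -- the levels `L_n = B + 2n`, `r_n = n`
  set B : ℝ := max L₀ (max (R + ε) 1) with hBdef
  have hB0 : L₀ ≤ B := le_max_left _ _
  have hB1 : R + ε ≤ B := (le_max_left _ _).trans (le_max_right _ _)
  have hB2 : 1 ≤ B := (le_max_right _ _).trans (le_max_right _ _)
  have hLn : ∀ n : ℕ, L₀ ≤ B + 2 * n ∧ R + ε ≤ B + 2 * n ∧ (0 : ℝ) ≤ n ∧ (n : ℝ) ≤ B + 2 * n := by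
    intro n
    have hn : (0 : ℝ) ≤ n := Nat.cast_nonneg n
    exact ⟨by linarith, by linarith, hn, by linarith⟩
  choose m hm1 hm2 hm3 hm4 hm5 hviol using
    fun n : ℕ => hcon (B + 2 * n) n (hLn n).1 (hLn n).2.1 (hLn n).2.2.1 (hLn n).2.2.2
  -- the generalised limit and the limiting family
  obtain ⟨Λ, hΛadd, hΛsmul, hΛpos, hΛone, hΛzero⟩ := stub_banachLimit
  have hΛpos' : ∀ a : ℕ → ℝ, (∀ n, True → 0 ≤ a n ∧ a n ≤ 1) → 0 ≤ Λ a :=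
    fun a ha => hΛpos a fun n => ha n trivial
  set ℓ : ℝ → (Finset (EuclideanSpace ℝ (Fin 3)) → ℝ) → ℝ :=
    fun ρ f => Λ (fun n => m n (fun S => f (ballPattern ρ S))) with hℓ
  -- (F1)–(F4): every `ℓ ρ` is a mean at level `(δ, ρ)`
  have F1 : ∀ (ρ : ℝ) (f₁ f₂ : Finset (EuclideanSpace ℝ (Fin 3)) → ℝ),
      ℓ ρ (f₁ + f₂) = ℓ ρ f₁ + ℓ ρ f₂ := by
    intro ρ f₁ f₂
    simp only [hℓ]
    rw [← hΛadd]
    congr 1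
    funext n
    simp only [Pi.add_apply]
    rw [← hm1 n]
    rfl
  have F2 : ∀ (ρ t : ℝ) (f : Finset (EuclideanSpace ℝ (Fin 3)) → ℝ), ℓ ρ (t • f) = t * ℓ ρ f := by
    intro ρ t f
    simp only [hℓ]
    rw [← hΛsmul]
    congr 1
    funext n
    simp only [Pi.smul_apply, smul_eq_mul]
    rw [← hm2 n]
    rfl
  have F3 : ∀ (ρ : ℝ) (f : Finset (EuclideanSpace ℝ (Fin 3)) → ℝ),
      (∀ S : Finset (EuclideanSpace ℝ (Fin 3)), IsRootedPattern δ ρ S → 0 ≤ f S ∧ f S ≤ 1) →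
      0 ≤ ℓ ρ f := by
    intro ρ f hf
    simp only [hℓ]
    refine hΛpos _ fun n => ?_
    exact levelLift_mean_mem_Icc (Ω := fun S => IsRootedPattern δ (B + 2 * n) S)
      (hm1 n) (hm2 n) (hm3 n) (hm4 n) zero_lt_one
      (fun S hS => hf _ (levelLift_isRootedPattern_ballPattern ρ hS))
  have F4 : ∀ ρ : ℝ, ℓ ρ (fun _ => 1) = 1 := by
    intro ρ
    simp only [hℓ]
    have h : (fun n => m n (fun _ => (1 : ℝ))) = fun _ => 1 := funext fun n => hm4 n
    rw [h, hΛone]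
  -- (F5): projectivity
  have F5 : ∀ ρ ρ' : ℝ, ρ ≤ ρ' → ∀ f : Finset (EuclideanSpace ℝ (Fin 3)) → ℝ,
      ℓ ρ' (fun S => f (ballPattern ρ S)) = ℓ ρ f := by
    intro ρ ρ' hρρ' f
    simp only [hℓ]
    congr 1
    funext n
    congr 1
    funext S
    rw [levelRestrict_ballPattern_ballPattern hρρ' S]
  -- (F6): lens-consistency at every level
  have F6 : ∀ r ρ : ℝ, 0 ≤ r →
      ∀ g : EuclideanSpace ℝ (Fin 3) → Finset (EuclideanSpace ℝ (Fin 3)) → Finset (EuclideanSpace ℝ (Fin 3)) → ℝ, (∃ M : ℝ, ∀ v p q, |g v p q| ≤ M) →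
        ℓ ρ (fun S => ∑ v ∈ Literature.Probability.PointProcesses.lens r ρ S, (g v (Literature.Probability.PointProcesses.ballPattern r S) (Literature.Probability.PointProcesses.ballPattern r (Literature.Probability.PointProcesses.reroot S v)) - g (-v) (Literature.Probability.PointProcesses.ballPattern r (Literature.Probability.PointProcesses.reroot S v)) (Literature.Probability.PointProcesses.ballPattern r S))) = 0 := by
    rintro r ρ hr g ⟨M, hM⟩
    simp only [hℓ]
    refine hΛzero _ ⟨⌈r⌉₊ + ⌈ρ⌉₊, fun n hn => ?_⟩
    have hn' : (⌈r⌉₊ : ℝ) + ⌈ρ⌉₊ ≤ n := by exact_mod_cast hn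
    have hrn : r ≤ n := (Nat.le_ceil r).trans (by linarith [(Nat.cast_nonneg ⌈ρ⌉₊ : (0:ℝ) ≤ ⌈ρ⌉₊)])
    have hρn : ρ - r ≤ B + 2 * n - n := by
      have h1 : ρ ≤ ⌈ρ⌉₊ := Nat.le_ceil ρ
      have h2 : (0 : ℝ) ≤ ⌈r⌉₊ := Nat.cast_nonneg _
      linarith
    have hM0 : 0 ≤ M := (abs_nonneg _).trans (hM 0 ∅ ∅)
    have key : (fun S : Finset (EuclideanSpace ℝ (Fin 3)) => ∑ v ∈ Literature.Probability.PointProcesses.lens r ρ (Literature.Probability.PointProcesses.ballPattern ρ S), (g v (Literature.Probability.PointProcesses.ballPattern r (Literature.Probability.PointProcesses.ballPattern ρ S)) (Literature.Probability.PointProcesses.ballPattern r (Literature.Probability.PointProcesses.reroot (Literature.Probability.PointProcesses.ballPattern ρ S) v)) - g (-v) (Literature.Probability.PointProcesses.ballPattern r (Literature.Probability.PointProcesses.reroot (Literature.Probability.PointProcesses.ballPattern ρ S) v)) (Literature.Probability.PointProcesses.ballPattern r (Literature.Probability.PointProcesses.ballPattern ρ S)))) =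
        fun S => ∑ v ∈ Literature.Probability.PointProcesses.lens (n : ℝ) (B + 2 * n) S, ((fun v p q => if ‖v‖ ≤ ρ - r then g v (Literature.Probability.PointProcesses.ballPattern r p) (Literature.Probability.PointProcesses.ballPattern r q) else 0) v (Literature.Probability.PointProcesses.ballPattern (n : ℝ) S) (Literature.Probability.PointProcesses.ballPattern (n : ℝ) (Literature.Probability.PointProcesses.reroot S v)) - (fun v p q => if ‖v‖ ≤ ρ - r then g v (Literature.Probability.PointProcesses.ballPattern r p) (Literature.Probability.PointProcesses.ballPattern r q) else 0) (-v) (Literature.Probability.PointProcesses.ballPattern (n : ℝ) (Literature.Probability.PointProcesses.reroot S v)) (Literature.Probability.PointProcesses.ballPattern (n : ℝ) S)) := by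
      funext S
      exact stub_levelRestrict r n ρ (B + 2 * n) hr hrn hρn g S
    rw [key]
    have h := hm5 n (fun v p q => if ‖v‖ ≤ ρ - r then g v (ballPattern r p) (ballPattern r q) else 0)
      ⟨M, fun v p q => by
        split_ifs
        · exact hM _ _ _
        · simpa using hM0⟩
    beta_reduce at h ⊢
    exact h
  -- the far field fixes the radius at which the hypothesis is applied
  obtain ⟨ρ₀, hfar⟩ := stub_patternFarField δ hδ η hη
  set ρs : ℝ := max (max (R + ε) 1) ρ₀ with hρs
  have hρs1 : R + ε ≤ ρs := (le_max_left _ _).trans (le_max_left _ _)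
  have hρs2 : 1 ≤ ρs := (le_max_right _ _).trans (le_max_left _ _)
  have hρs3 : ρ₀ ≤ ρs := le_max_right _ _
  have hkey := hprim ℓ F1 F2 F3 F4 F5 F6 ρs hρs1 hρs2
  simp only [hℓ] at hkey
  -- the defect indicator is a cylinder functional
  have hbadB : (fun n => m n (fun S : Finset (EuclideanSpace ℝ (Fin 3)) => (if (∃ A : EuclideanSpace ℝ (Fin 3) →ₗᵢ[ℝ] EuclideanSpace ℝ (Fin 3), (∀ p ∈ P.points, ‖p‖ ≤ R → ∃ v ∈ insert (0 : EuclideanSpace ℝ (Fin 3)) (Literature.Probability.PointProcesses.ballPattern ρs S), dist v (A p) ≤ ε) ∧ (∀ v ∈ insert (0 : EuclideanSpace ℝ (Fin 3)) (Literature.Probability.PointProcesses.ballPattern ρs S), ‖v‖ ≤ R → ∃ p ∈ P.points, dist v (A p) ≤ ε)) then (0 : ℝ) else 1))) =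
      fun n => m n (fun S => (if (∃ A : EuclideanSpace ℝ (Fin 3) →ₗᵢ[ℝ] EuclideanSpace ℝ (Fin 3), (∀ p ∈ P.points, ‖p‖ ≤ R → ∃ v ∈ insert (0 : EuclideanSpace ℝ (Fin 3)) S, dist v (A p) ≤ ε) ∧ (∀ v ∈ insert (0 : EuclideanSpace ℝ (Fin 3)) S, ‖v‖ ≤ R → ∃ p ∈ P.points, dist v (A p) ≤ ε)) then (0 : ℝ) else 1)) := by
    funext n
    congr 1
    funext S
    rw [levelLift_good_ballPattern_iff P hε.le hρs1 S]
  rw [hbadB] at hkey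
  -- the sequences `b_n = m_n (bad)` and `s_n = m_n (½ h ∘ B_ρs)`
  set b : ℕ → ℝ := fun n => m n (fun S => (if (∃ A : EuclideanSpace ℝ (Fin 3) →ₗᵢ[ℝ] EuclideanSpace ℝ (Fin 3), (∀ p ∈ P.points, ‖p‖ ≤ R → ∃ v ∈ insert (0 : EuclideanSpace ℝ (Fin 3)) S, dist v (A p) ≤ ε) ∧ (∀ v ∈ insert (0 : EuclideanSpace ℝ (Fin 3)) S, ‖v‖ ≤ R → ∃ p ∈ P.points, dist v (A p) ≤ ε)) then (0 : ℝ) else 1)) with hb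
  have hb01 : ∀ n, 0 ≤ b n ∧ b n ≤ 1 := fun n =>
    levelLift_mean_mem_Icc (Ω := fun S => IsRootedPattern δ (B + 2 * n) S)
      (hm1 n) (hm2 n) (hm3 n) (hm4 n) zero_lt_one (fun S _ => by split_ifs <;> norm_num)
  obtain ⟨Mρ, hMρ⟩ := levelLift_abs_sum_le hδ ρs
  have hMρ0 : 0 ≤ Mρ := (abs_nonneg _).trans (hMρ ∅ (Literature.Probability.PointProcesses.isRootedPattern_empty δ ρs))
  set s : ℕ → ℝ := fun n => m n (fun S : Finset (EuclideanSpace ℝ (Fin 3)) => (∑ v ∈ (Literature.Probability.PointProcesses.ballPattern ρs S), Literature.MathematicalPhysics.StatisticalMechanics.lennardJones ‖v‖) / 2) with hs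
  have hsbd : ∀ n, -(Mρ / 2 + 1) ≤ s n ∧ s n ≤ Mρ / 2 + 1 := by
    intro n
    refine levelLift_mean_mem_Icc (Ω := fun S => IsRootedPattern δ (B + 2 * n) S)
      (hm1 n) (hm2 n) (hm3 n) (hm4 n) (by linarith) (fun S hS => ?_)
    have h := hMρ _ (levelLift_isRootedPattern_ballPattern ρs hS)
    rw [abs_le] at h
    constructor <;> linarith [h.1, h.2]
  -- the violation, transported to the ρs-ball by the far field
  have hstep : ∀ n, s n ≤ (c - η / 2) + κ * b n := by
    intro n
    have hmono : s n ≤ m n (fun S => (∑ v ∈ S, Literature.MathematicalPhysics.StatisticalMechanics.lennardJones ‖v‖) / 2 + η / 2) := by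
      refine levelLift_mean_mono (Ω := fun S => IsRootedPattern δ (B + 2 * n) S)
        (hm1 n) (hm2 n) (hm3 n) (M := η) hη (fun S hS => ?_) (fun S hS => ?_)
      · have hf := hfar ρs (B + 2 * n) hρs3 S hS
        have hsplit := Finset.sum_filter_add_sum_filter_not S (fun v => ‖v‖ ≤ ρs)
          (fun v => lennardJones ‖v‖)
        have hball : ∑ v ∈ ballPattern ρs S, lennardJones ‖v‖ =
            ∑ v ∈ S.filter (fun v => ‖v‖ ≤ ρs), lennardJones ‖v‖ := rfl
        rw [hball]
        linarith
      · have hsplit := Finset.sum_filter_add_sum_filter_not S (fun v => ‖v‖ ≤ ρs)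
          (fun v => lennardJones ‖v‖)
        have hball : ∑ v ∈ ballPattern ρs S, lennardJones ‖v‖ =
            ∑ v ∈ S.filter (fun v => ‖v‖ ≤ ρs), lennardJones ‖v‖ := rfl
        have hfar0 : ∑ v ∈ S.filter (fun v => ¬ ‖v‖ ≤ ρs), lennardJones ‖v‖ ≤ 0 := by
          refine Finset.sum_nonpos fun v hv => ?_
          simp only [Finset.mem_filter, not_le] at hv
          exact Literature.MathematicalPhysics.StatisticalMechanics.lennardJones_nonpos (by linarith [hv.2])
        rw [hball]
        linarith
    have hconst : m n (fun S => (∑ v ∈ S, Literature.MathematicalPhysics.StatisticalMechanics.lennardJones ‖v‖) / 2 + η / 2) = m n (fun S => (∑ v ∈ S, Literature.MathematicalPhysics.StatisticalMechanics.lennardJones ‖v‖) / 2) + η / 2 := by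
      have h : (fun S : Finset (EuclideanSpace ℝ (Fin 3)) => (∑ v ∈ S, Literature.MathematicalPhysics.StatisticalMechanics.lennardJones ‖v‖) / 2 + η / 2) =
          (fun S => (∑ v ∈ S, Literature.MathematicalPhysics.StatisticalMechanics.lennardJones ‖v‖) / 2) + (fun _ => η / 2) := by
        funext S; simp only [Pi.add_apply]
      rw [h, hm1 n, levelLift_mean_const (hm2 n) (hm4 n)]
    have hv := hviol n
    linarith
  -- apply Λ (monotone on bounded sequences, linear)
  have hΛmono : Λ s ≤ Λ (fun n => (c - η / 2) + κ * b n) := by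
    refine levelLift_mean_mono (Ω := fun _ => True) hΛadd hΛsmul hΛpos'
      (M := |c - η / 2| + |κ| + (Mρ / 2 + 1) + 1) (by positivity) (fun n _ => hstep n) (fun n _ => ?_)
    have h1 : κ * b n ≤ |κ| := by
      calc κ * b n ≤ |κ * b n| := le_abs_self _
        _ = |κ| * |b n| := abs_mul _ _
        _ ≤ |κ| * 1 := by gcongr; rw [abs_le]; constructor <;> linarith [(hb01 n).1, (hb01 n).2]
        _ = |κ| := mul_one _
    linarith [le_abs_self (c - η / 2), (hsbd n).1]
  have hΛlin : Λ (fun n => (c - η / 2) + κ * b n) = (c - η / 2) + κ * Λ b := by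
    have h : (fun n => (c - η / 2) + κ * b n) = (fun _ => c - η / 2) + κ • b := by
      funext n; simp only [Pi.add_apply, Pi.smul_apply, smul_eq_mul]
    rw [h, hΛadd, hΛsmul, levelLift_mean_const hΛsmul hΛone]
  have hs_eq : Λ (fun n => m n (fun S : Finset (EuclideanSpace ℝ (Fin 3)) => (∑ v ∈ (Literature.Probability.PointProcesses.ballPattern ρs S), Literature.MathematicalPhysics.StatisticalMechanics.lennardJones ‖v‖) / 2)) = Λ s := rfl
  rw [hs_eq] at hkey
  linarith

end Summit.AtomisticToContinuum.Crystallization.Theorems.PatternPricedCertificates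

end
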